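import Summits.BirchSwinnertonDyer.BirchSwinnertonDyer.Theorems.Rank1ResidualJetThm63LocalFactsPrime
import Summits.BirchSwinnertonDyer.BirchSwinnertonDyer.Theorems.Rank1ResidualJetCarrierRowData
import Summits.BirchSwinnertonDyer.BirchSwinnertonDyer.Theorems.Rank1ResidualJetCoreVertexBridge
import HarnessLib

/-!
# T1 JET (cell `bsd-jet`), road K — END FORM for the bucket-B reading binder K3: `(J∣N)` at a
# MULTIPLICATIVE carrier `p` from named print + typed local facts + the three completion-layer gaps

HONEST FRAMING (programme file §HONESTY, verbatim): «no tranche here proves BSD; ARM L moves the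
LITERAL column of an r ≤ 1 census into the kernel-proved-modulo-named-print column.» THEOREMS ONLY
(seat `bsd-jet-pv-2`, session g4; `--supports stmt-BirchSwinnertonDyer-14418`, helper); 0 classes
move; K3 stays `@[conjecture]`. WHAT THIS IS. The bridge
`jetchevDivisibilityCarrierMult_of_prop52_of_coreVertexExistence` (p488446) reduces the reading binder
`JET.JetchevDivisibilityCarrierMult` (K3: Jetchev's Thm. 1.4 read at a multiplicative `p ∣ N`) to
McCallum Prop. 5.2 (`h52`), the core-vertex existence K5 (`hCV`), ring class fields (`hRCF`) and ONE
kernel hypothesis `H63` = [J] Thm. 5.2 instantiated on the row objects. This file DISCHARGES `H63`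
from the H63 line of this seat (`JET.tamagawaExponent_le_mInfty_of_localFacts'`, p515562: every
structure-level parameter and every plumbing input is a tree theorem) and the carrier transport
(`carrierRowData_of_split`, p516218: the row data over `K_{v₀}` are the `ℚ_p`-data), so that K3 follows
from CLOSED statements only, each of one of four kinds:
* NAMED PRINT: `h52` [McC 5.2], `hCV` K5 (C R467), `h44` [McC 4.4], `hPT` Poitou–Tate for Selmer
  structures, `h53` Gross 1991 Prop. 5.3 (schema), `hGZ` [GZ86 III (3.1)] receptacle (schema), `hRCF`;
* LOCAL PRINT-TO-TYPE (Jetchev Lemma 5.2 / Howard 2004 Prop. 2.1.7, 2.1.9 / Gross §3): `hloc`,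
  `h𝒯sd`, `h𝒯σ` — statements about ONE completion, in the currency of the intrinsic transverse family;
* ROW/CARRIER datum: `hΦ` (Kodaira–Néron: for `p` odd and `p ∣ c_ℓ` the component group `E(ℚ_ℓ)/E₀` is cyclic —
  Tate's algorithm table: `Φ ∈ {ℤ/n, ℤ/2 × ℤ/2, ℤ/3, ℤ/4, ℤ/2, 0}`; the tree proves the split
  multiplicative case, `isAddCyclic_quotient_goodReductionSubgroup_of_hasSplitMultiplicativeReduction`);
* the THREE completion-layer KERNEL GAPS `htr` (≡ `h49tr`, Howard 2004 Lemma 2.7.3 transverseness —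
  `h49tr` is DERIVED here from `htr` at level `cℓ` by G2♯) and `h49str` (Jetchev Prop. 4.9 proper).
Nothing else. (If `p ∤ c_p` the conclusion `ord_p c_p ≤ m_∞` is trivial and no input is used.)
References: [cite: Jetchev2008, Thm. 1.4 / Cor. 1.5, Thm. 5.2, Prop. 5.3, Lemma 5.2, Prop. 4.9]
[cite: McCallumLMS1991, Prop. 4.4, Prop. 5.2] [cite: GrossLMS1991, §3, Prop. 5.3]
[cite: GrossZagier1986, III (3.1)] [cite: Howard2004HeegnerKolyvagin, Prop. 2.1.7, 2.1.9, Lemma 2.7.3]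
[cite: MilneADT2006, Ch. I, Thm. 4.10(b)].
-/

set_option autoImplicit false

noncomputable section

open scoped Classical Pointwise

open WeierstrassCurve IsDedekindDomain NumberField Field Literature.NumberTheory.EllipticCurves
  Literature.NumberTheory.EllipticCurves.ModularForms Literature.NumberTheory.EllipticCurves.Jetchev2008
  Literature.NumberTheory.GaloisRepresentations Literature.NumberTheory.GaloisCohomology
  Literature.NumberTheory.GaloisRepresentations.DiscreteGaloisModule
  Summit.BirchSwinnertonDyer.Rank1Residual.X11b Summit.BirchSwinnertonDyer.Rank1Residual.X11b.Three
  Summit.BirchSwinnertonDyer.Rank1Residual.JET.SelmerVocabulary Literature.NumberTheory.Automorphic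

namespace Summit.BirchSwinnertonDyer.Rank1Residual.JET

/-- **The carrier place over a prime of the level.** For `K` imaginary quadratic with the Heegner
hypothesis for `N`, `τ ≠ 1` in `Aut(K/ℚ)` and a prime `q ∣ N`: there is a place `v₀ ∋ q` of `K` with
`τ • v₀ ≠ v₀` (the two primes over the split `q` are permuted by `Gal(K/ℚ)`, Cassels–Fröhlich VII
Prop. 1.2 (ii)), and `N ∈ v₀`. [cite: GrossLMS1991, §1 (Heegner hypothesis)]
[cite: CasselsFrohlichANT1967, Ch. VII Prop. 1.2 (ii)] -/
theorem exists_split_place_of_dvd {N : ℕ} (K : Type) [Field K] [NumberField K]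
    (hK : IsImaginaryQuadratic K) (τ : K ≃ₐ[ℚ] K) (hτ : τ ≠ 1) (hH : SatisfiesHeegnerHypothesis N K)
    (q : ℕ) [Fact q.Prime] (hqN : q ∣ N) :
    ∃ v₀ : HeightOneSpectrum (𝓞 K), τ • v₀ ≠ v₀ ∧ ((N : ℕ) : 𝓞 K) ∈ v₀.asIdeal ∧
      ((q : ℕ) : 𝓞 K) ∈ v₀.asIdeal := by
  have hq : q.Prime := Fact.out
  haveI : Algebra.IsQuadraticExtension ℚ K := ⟨hK.1⟩
  -- the two primes of `K` over `q`
  obtain ⟨P₁, P₂, hne, hset⟩ := Set.ncard_eq_two.mp (hH q hq hqN)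
  have hP₁ : P₁ ∈ (Ideal.span {(q : ℤ)}).primesOver (𝓞 K) := by rw [hset]; exact Set.mem_insert _ _
  have hP₂ : P₂ ∈ (Ideal.span {(q : ℤ)}).primesOver (𝓞 K) := by
    rw [hset]; exact Set.mem_insert_of_mem _ rfl
  have hmemq : ∀ P ∈ (Ideal.span {(q : ℤ)}).primesOver (𝓞 K), ((q : ℕ) : 𝓞 K) ∈ P := by
    rintro P ⟨_, hLO⟩
    have h1 : (q : ℤ) ∈ Ideal.span {(q : ℤ)} := Ideal.mem_span_singleton_self _
    rw [hLO.over, Ideal.mem_comap] at h1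
    simpa using h1
  have hnebot : ∀ P ∈ (Ideal.span {(q : ℤ)}).primesOver (𝓞 K), P ≠ ⊥ := by
    intro P hP hbot
    have := hmemq P hP
    rw [hbot, Ideal.mem_bot] at this
    exact hq.ne_zero (by exact_mod_cast this)
  let v₁ : HeightOneSpectrum (𝓞 K) := ⟨P₁, hP₁.1, hnebot P₁ hP₁⟩
  let v₂ : HeightOneSpectrum (𝓞 K) := ⟨P₂, hP₂.1, hnebot P₂ hP₂⟩
  -- both lie over the place `(q)` of `ℚ`
  have hunder : ∀ v : HeightOneSpectrum (𝓞 K), ((q : ℕ) : 𝓞 K) ∈ v.asIdeal →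
      v.under (𝓞 ℚ) = (Rat.HeightOneSpectrum.primesEquiv (R := 𝓞 ℚ)).symm ⟨q, hq⟩ := fun v hv ↦
    (natCast_mem_asIdeal_iff_eq_primesEquiv_symm (v.under (𝓞 ℚ)) hq).mp
      (LocalField.natCast_mem_under q v hv)
  have h12 : v₁.under (𝓞 ℚ) = v₂.under (𝓞 ℚ) := by
    rw [hunder v₁ (hmemq P₁ hP₁), hunder v₂ (hmemq P₂ hP₂)]
  obtain ⟨σ, hσ⟩ := HeightOneSpectrum.exists_algEquiv_smul_eq ℚ h12
  -- `σ ≠ 1`, hence `σ = τ`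
  have hσ1 : σ ≠ 1 := by
    rintro rfl
    rw [one_smul] at hσ
    exact hne (congrArg HeightOneSpectrum.asIdeal hσ)
  have hcard : Nat.card (K ≃ₐ[ℚ] K) = 2 := by rw [IsGalois.card_aut_eq_finrank, hK.1]
  obtain ⟨y, -, hyu⟩ := (Nat.card_eq_two_iff' (1 : K ≃ₐ[ℚ] K)).mp hcard
  have hστ : σ = τ := (hyu σ hσ1).trans (hyu τ hτ).symm
  refine ⟨v₁, ?_, ?_, hmemq P₁ hP₁⟩
  · rw [← hστ, hσ]
    exact fun h ↦ hne (congrArg HeightOneSpectrum.asIdeal h).symm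
  · obtain ⟨r, hr⟩ := hqN
    rw [hr, Nat.cast_mul]
    exact v₁.asIdeal.mul_mem_right _ (hmemq P₁ hP₁)

/-- **The carrier place at a multiplicative prime.** `p` of multiplicative reduction divides `N_E`
(multiplicative is bad: `v(Δ_min) < 1`), so `exists_split_place_of_dvd` applies.
[cite: GrossLMS1991, §1] [cite: SilvermanAEC2009, VII.5 Prop. 5.1] -/
theorem exists_split_carrier_place (W : WeierstrassCurve ℚ) [W.IsElliptic] (K : Type) [Field K]
    [NumberField K] (hK : IsImaginaryQuadratic K) (τ : K ≃ₐ[ℚ] K) (hτ : τ ≠ 1)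
    (hH : SatisfiesHeegnerHypothesis (W.conductorNorm ℤ) K) (p : ℕ) [Fact p.Prime]
    (hmult : W.HasMultiplicativeReductionAtPrime p) :
    ∃ v₀ : HeightOneSpectrum (𝓞 K), τ • v₀ ≠ v₀ ∧
      ((W.conductorNorm ℤ : ℕ) : 𝓞 K) ∈ v₀.asIdeal ∧ ((p : ℕ) : 𝓞 K) ∈ v₀.asIdeal := by
  have hpN : p ∣ W.conductorNorm ℤ := by
    rw [dvd_conductorNorm_iff_not_hasGoodReductionAtPrime]
    intro hgood
    exact absurd hgood.goodReduction (ne_of_lt hmult.badReduction)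
  exact exists_split_place_of_dvd K hK τ hτ hH p hpN

/-- **K3 ⟸ named print + local print-to-type + carrier plumbing + the three completion-layer gaps.**
See the module docstring for the classification of the hypotheses; the conclusion is the reading
binder `JET.JetchevDivisibilityCarrierMult` (Jetchev Thm. 1.4 / Cor. 1.5 read at a multiplicative
carrier `p ∣ N`). [cite: Jetchev2008, Thm. 1.4, Thm. 5.2, Prop. 5.3] [cite: McCallumLMS1991, Prop. 5.2] -/
theorem jetchevDivisibilityCarrierMult_of_localFacts
    -- NAMED PRINT
    (h52 : McCallum1991.prop52_exists_conductor_kolyvaginClass_order_eq)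
    (hCV : JetchevCoreVertexExistence)
    (hRCF : ∀ (K : Type) [Field K] [NumberField K] (ι : K →+* ℂ), IsImaginaryQuadratic K →
      ∀ k : ℕ, NumberField (ringClassField K ι k))
    (h44 : McCallum1991.prop44_localOrder_kolyvaginClass_mul_eq)
    (hPT : ∀ (K : Type) [Field K] [NumberField K], poitouTate_selmerStructure_duality_conj K)
    (h53 : ∀ (W : WeierstrassCurve ℚ) [W.IsElliptic] [NeZero (W.conductorNorm ℤ)]
      (K : Type) [Field K] [NumberField K]
      (Dt : ModularParametrizationData W (W.conductorNorm ℤ)) (β : ℤ) (ι : K →+* ℂ)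
      [∀ j : ℕ, NumberField (ringClassField K ι j)],
      ∃ ε : ℤ, (ε = 1 ∨ ε = -1) ∧ ∀ (m : ℕ) (dm : KolyvaginHeegnerData Dt β ι m)
        (τm : ringClassField K ι m ≃ₐ[ℚ] ringClassField K ι m),
        (∀ x : ringClassField K ι m, ((τm x : ringClassField K ι m) : ℂ) = starRingEnd ℂ x) →
        ∃ σ' ∈ ringClassGal ι m, IsOfFinAddOrder
          (pointGalHom W (ringClassField K ι m) τm dm.y -
            ε • pointGalHom W (ringClassField K ι m) σ' dm.y))
    (hGZ : ∀ (W : WeierstrassCurve ℚ) [W.IsElliptic] [NeZero (W.conductorNorm ℤ)]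
      (K : Type) [Field K] [NumberField K] (p : ℕ) [Fact p.Prime]
      (Dt : ModularParametrizationData W (W.conductorNorm ℤ)) (β : ℤ) (ι : K →+* ℂ)
      [∀ j : ℕ, NumberField (ringClassField K ι j)],
      ∃ n' : ℤ, IsCoprime (p : ℤ) n' ∧ ∀ (m : ℕ) (dm : KolyvaginHeegnerData Dt β ι m)
        (γ : ringClassField K ι m ≃ₐ[ℚ] ringClassField K ι m), γ ∈ ringClassGal ι m →
        ∀ v : HeightOneSpectrum (𝓞 K), ¬ (W.baseChange K).HasGoodReductionAt v →
          n' • pointsMap (W.baseChange K) (v.adicCompletion K)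
              (dm.toGeomPoints (pointGalHom W (ringClassField K ι m) γ dm.y)) ∈
            E0Receptacle (W.baseChange K) v ∧
          ∀ (ℓ : ℕ), ℓ ∈ m.primeFactors → ∀ (dm' : KolyvaginHeegnerData Dt β ι (m / ℓ))
            (hle : ringClassField K ι (m / ℓ) ≤ ringClassField K ι m),
            n' • pointsMap (W.baseChange K) (v.adicCompletion K)
                (dm.toGeomPoints (pointGalHom W (ringClassField K ι m) γ
                  (WeierstrassCurve.Affine.Point.map (W' := W)
                    ((RingClassField.inclusion ι hle).restrictScalars ℚ) dm'.y))) ∈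
              E0Receptacle (W.baseChange K) v)
    -- LOCAL PRINT-TO-TYPE
    (hloc : ∀ (W : WeierstrassCurve ℚ) [W.IsElliptic] [W.IsGloballyMinimal]
      (K : Type) [Field K] [NumberField K], IsImaginaryQuadratic K →
      ∀ (τ : K ≃ₐ[ℚ] K), τ ≠ 1 → ∀ (p k : ℕ) [Fact p.Prime], p ≠ 2 → 1 ≤ k →
      ∀ (ℓ : ℕ), Zhang2014.IsKolyvaginPrime (W.conductorNorm ℤ) W K p ℓ →
        k ≤ Zhang2014.kolyvaginIndex W p ℓ →
      ∀ (v : HeightOneSpectrum (𝓞 K)), (ℓ : 𝓞 K) ∈ v.asIdeal → ∀ (hfix : τ • v = v)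
        (s : ℤ), s = 1 ∨ s = -1 →
      ((W.baseChange K).kummerSelmerStructure ((p ^ k : ℕ) : ℤ) (Sum.inr v)).relIndex
        ((conjActPlace W τ ((p ^ k : ℕ) : ℤ) hfix - s • AddMonoidHom.id _).ker) = p ^ k)
    (h𝒯σ : ∀ (W : WeierstrassCurve ℚ) [W.IsElliptic] [W.IsGloballyMinimal]
      (K : Type) [Field K] [NumberField K], IsImaginaryQuadratic K →
      ∀ (ι : K →+* ℂ) [∀ j : ℕ, NumberField (ringClassField K ι j)] (τ : K ≃ₐ[ℚ] K), τ ≠ 1 →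
      ∀ (p k : ℕ) [Fact p.Prime], p ≠ 2 →
      ∀ (c : ℕ), Squarefree c → (∀ ℓ ∈ c.primeFactors,
        Zhang2014.IsKolyvaginPrime (W.conductorNorm ℤ) W K p ℓ ∧ k ≤ Zhang2014.kolyvaginIndex W p ℓ) →
      ∀ (𝒯 : SelmerStructure ((W.baseChange K).torsionGaloisModule ((p ^ k : ℕ) : ℤ))),
      (∀ v : HeightOneSpectrum (𝓞 K), 𝒯 (Sum.inr v) =
        ⨅ ℓ ∈ c.primeFactors.filter (fun ℓ : ℕ ↦ ((ℓ : ℕ) : 𝓞 K) ∈ v.asIdeal),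
          ⨅ (w' : HeightOneSpectrum (𝓞 (ringClassField K ι ℓ))) (_ : w'.asIdeal.LiesOver v.asIdeal),
            letI := (adicCompletionOfLiesOver K (ringClassField K ι ℓ) v w').toAlgebra
            transverseSubgroup (GaloisRep.toLocal v ((W.baseChange K).torsionGaloisModule ((p ^ k : ℕ) : ℤ)))
              (w'.adicCompletion (ringClassField K ι ℓ))) →
      ∀ (v w : HeightOneSpectrum (𝓞 K)) (h : τ • v = w), v ∈ placesDividing K c →
      ∀ x : galoisCohomology (((W.baseChange K).torsionGaloisModule ((p ^ k : ℕ) : ℤ)).toLocal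
        (Sum.inr v : Place K)) 1,
      x ∈ 𝒯 (Sum.inr v) → conjActPlace W τ ((p ^ k : ℕ) : ℤ) h x ∈ 𝒯 (Sum.inr w))
    (h𝒯sd : ∀ (W : WeierstrassCurve ℚ) [W.IsElliptic] [W.IsGloballyMinimal]
      (K : Type) [Field K] [NumberField K], IsImaginaryQuadratic K →
      ∀ (ι : K →+* ℂ) [∀ j : ℕ, NumberField (ringClassField K ι j)]
      (p k : ℕ) [Fact p.Prime] [NeZero (p ^ k)] [Finite (geomTorsion (W.baseChange K) ((p ^ k : ℕ) : ℤ))],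
      p ≠ 2 → ∀ (c : ℕ), Squarefree c → (∀ ℓ ∈ c.primeFactors,
        Zhang2014.IsKolyvaginPrime (W.conductorNorm ℤ) W K p ℓ ∧ k ≤ Zhang2014.kolyvaginIndex W p ℓ) →
      ∀ (𝒯 : SelmerStructure ((W.baseChange K).torsionGaloisModule ((p ^ k : ℕ) : ℤ))),
      (∀ v : HeightOneSpectrum (𝓞 K), 𝒯 (Sum.inr v) =
        ⨅ ℓ ∈ c.primeFactors.filter (fun ℓ : ℕ ↦ ((ℓ : ℕ) : 𝓞 K) ∈ v.asIdeal),
          ⨅ (w' : HeightOneSpectrum (𝓞 (ringClassField K ι ℓ))) (_ : w'.asIdeal.LiesOver v.asIdeal),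
            letI := (adicCompletionOfLiesOver K (ringClassField K ι ℓ) v w').toAlgebra
            transverseSubgroup (GaloisRep.toLocal v ((W.baseChange K).torsionGaloisModule ((p ^ k : ℕ) : ℤ)))
              (w'.adicCompletion (ringClassField K ι ℓ))) →
      ∀ (e : geomTorsion (W.baseChange K) ((p ^ k : ℕ) : ℤ) →
          geomTorsion (W.baseChange K) ((p ^ k : ℕ) : ℤ) → AlgebraicClosure K)
        (hμ : ∀ S T, e S T ^ (p ^ k) = 1)
        (hadd₁ : ∀ S₁ S₂ T, e (S₁ + S₂) T = e S₁ T * e S₂ T)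
        (hadd₂ : ∀ S T₁ T₂, e S (T₁ + T₂) = e S T₁ * e S T₂)
        (hgal : ∀ (g : absoluteGaloisGroup K) (S T : geomTorsion (W.baseChange K) ((p ^ k : ℕ) : ℤ)),
          g • e S T = e (g • S) (g • T)),
      (∀ T, e T T = 1) → (∀ T, (∀ S, e S T = 1) → T = 0) →
      ∀ inv : LocalInvariants K (p ^ k), inv.IsPerfect → ∀ v ∈ placesDividing K c,
      inv.dualTransported 𝒯 (weilDualIntertwining (W.baseChange K) (p ^ k) e hμ hadd₁ hadd₂ hgal)
        (Sum.inr v) = 𝒯 (Sum.inr v))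
    -- ROW / CARRIER datum (Kodaira–Néron)
    (hΦ : ∀ (W : WeierstrassCurve ℚ) [W.IsElliptic] [W.IsGloballyMinimal] (ℓ p : ℕ) [Fact ℓ.Prime]
      [Fact p.Prime], p ≠ 2 → p ∣ (W.baseChange ℚ_[ℓ]).localTamagawaNumber ℤ_[ℓ] →
      ∀ [(W.baseChange ℚ_[ℓ]).IsMinimal ℤ_[ℓ]],
      IsAddCyclic ((W.baseChange ℚ_[ℓ]).toAffine.Point ⧸ (W.baseChange ℚ_[ℓ]).goodReductionSubgroup ℤ_[ℓ]))
    -- the completion-layer KERNEL GAPS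
    (htr : ∀ (W : WeierstrassCurve ℚ) [W.IsElliptic] [W.IsGloballyMinimal] [NeZero (W.conductorNorm ℤ)]
      (K : Type) [Field K] [NumberField K], IsImaginaryQuadratic K →
      ∀ (p : ℕ) [Fact p.Prime], p ≠ 2 →
      ∀ (Dt : ModularParametrizationData W (W.conductorNorm ℤ)) (β : ℤ) (ι : K →+* ℂ)
        [∀ j : ℕ, NumberField (ringClassField K ι j)]
        (k : ℕ) (c : ℕ), Squarefree c →
        (∀ ℓ ∈ c.primeFactors, Zhang2014.IsKolyvaginPrime (W.conductorNorm ℤ) W K p ℓ ∧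
          k ≤ Zhang2014.kolyvaginIndex W p ℓ) →
      ∀ (d : KolyvaginHeegnerData Dt β ι c), ∀ ℓ ∈ c.primeFactors,
        (d.kolyvaginClass (Fact.out : p.Prime) k :
          galoisCohomology ((W.baseChange K).torsionGaloisModule ((p ^ k : ℕ) : ℤ)) 1) ∈
          transverseKer W K ι ((p ^ k : ℕ) : ℤ) ℓ)
    (h49str : ∀ (W : WeierstrassCurve ℚ) [W.IsElliptic] [W.IsGloballyMinimal] [NeZero (W.conductorNorm ℤ)]
      (K : Type) [Field K] [NumberField K], IsImaginaryQuadratic K →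
      SatisfiesHeegnerHypothesis (W.conductorNorm ℤ) K →
      ∀ (p : ℕ) [Fact p.Prime], p ≠ 2 →
      ∀ (Dt : ModularParametrizationData W (W.conductorNorm ℤ)) (β : ℤ) (ι : K →+* ℂ)
        [∀ j : ℕ, NumberField (ringClassField K ι j)]
        (k : ℕ) (hn : ((p ^ k : ℕ) : ℤ) ≠ 0) (c : ℕ), Squarefree c →
        (∀ ℓ ∈ c.primeFactors, Zhang2014.IsKolyvaginPrime (W.conductorNorm ℤ) W K p ℓ ∧
          k ≤ Zhang2014.kolyvaginIndex W p ℓ) →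
      ∀ (q : HeightOneSpectrum (𝓞 K)), ((W.conductorNorm ℤ : ℕ) : 𝓞 K) ∈ q.asIdeal →
      ∀ (ℓ : ℕ), Zhang2014.IsKolyvaginPrime (W.conductorNorm ℤ) W K p ℓ →
        k ≤ Zhang2014.kolyvaginIndex W p ℓ → ℓ ∉ c.primeFactors →
      ∀ (d' : KolyvaginHeegnerData Dt β ι (c * ℓ)),
        galoisCohomology.localization ((W.baseChange K).torsionGaloisModule ((p ^ k : ℕ) : ℤ))
            (Sum.inr q) 1 (d'.kolyvaginClass (Fact.out : p.Prime) k) ∈ stringentFamily W K hn (Sum.inr q)) :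
    JetchevDivisibilityCarrierMult := by
  refine jetchevDivisibilityCarrierMult_of_prop52_of_coreVertexExistence h52 hCV hRCF ?_
  intro W _ _ _ hcm K _ _ hK hD3 hD4 hH τ hτ p _ hp2 hmult htower Dt β ι _ d₁ _ mdiv m hmdiv hm mInf
    _ _ k c hk hcore hmc hkM htk hik
  have hp : p.Prime := Fact.out
  -- trivial case: `p ∤ c_p`
  by_cases ht0 : padicValNat p ((W.baseChange ℚ_[p]).localTamagawaNumber ℤ_[p]) = 0
  · rw [ht0]; exact Nat.zero_le _
  have hdvd : p ∣ (W.baseChange ℚ_[p]).localTamagawaNumber ℤ_[p] :=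
    dvd_of_one_le_padicValNat (Nat.one_le_iff_ne_zero.mpr ht0)
  -- the carrier place `v₀ ∣ p`, split, and the transport of the row data
  obtain ⟨v₀, hv₀, hv₀N, hpv₀⟩ := exists_split_carrier_place W K hK τ hτ hH p hmult
  obtain ⟨hminK, hminP, hcEq, hc0, hcyc⟩ := carrierRowData_of_split W K p hK τ v₀ hv₀ hpv₀
  haveI := hminK
  haveI := hminP
  haveI := hcyc (hΦ W p p hp2 hdvd)
  -- `τ² = 1`
  haveI : Algebra.IsQuadraticExtension ℚ K := ⟨hK.1⟩
  have hτ2 : τ * τ = 1 := by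
    have hcard : Nat.card (K ≃ₐ[ℚ] K) = 2 := by rw [IsGalois.card_aut_eq_finrank, hK.1]
    obtain ⟨y, -, hyu⟩ := (Nat.card_eq_two_iff' (1 : K ≃ₐ[ℚ] K)).mp hcard
    have h1 : τ = y := hyu τ hτ
    have h2 : τ⁻¹ = y := hyu τ⁻¹ (inv_ne_one.mpr hτ)
    rw [mul_eq_one_iff_eq_inv]
    exact h1.trans h2.symm
  -- instances at level `p^k`
  haveI : NeZero (p ^ k) := ⟨pow_ne_zero k hp.ne_zero⟩
  haveI : Finite (geomTorsion (W.baseChange K) ((p ^ k : ℕ) : ℤ)) :=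
    finite_geomTorsion_of_neZero (W.baseChange K) (p ^ k)
  have hn : ((p ^ k : ℕ) : ℤ) ≠ 0 := by exact_mod_cast pow_ne_zero k hp.ne_zero
  -- the named-print schemas at this frame
  obtain ⟨ε, hε, h53'⟩ := h53 W K Dt β ι
  obtain ⟨n', hcop', hGZ'⟩ := hGZ W K p Dt β ι
  -- Kolyvagin data of the core vertex
  have hc0' : c.1 ≠ 0 := c.2.1.ne_zero
  have hkc : (k : ℕ∞) ≤ Zhang2014.levelIndex W p c.1 := le_trans le_self_add hkM
  have hcK : ∀ ℓ ∈ c.1.primeFactors, Zhang2014.IsKolyvaginPrime (W.conductorNorm ℤ) W K p ℓ ∧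
      k ≤ Zhang2014.kolyvaginIndex W p ℓ := fun ℓ hℓ ↦
    ⟨c.2.2 ℓ hℓ, Zhang2014.natCast_le_levelIndex_iff.mp hkc ℓ hℓ⟩
  -- the exponent
  have hfac : (((W.baseChange K).baseChange (v₀.adicCompletion K)).localTamagawaNumber
      (v₀.adicCompletionIntegers K)).factorization p =
      padicValNat p ((W.baseChange ℚ_[p]).localTamagawaNumber ℤ_[p]) := by
    rw [hcEq, Nat.factorization_def _ hp]
  have htk' : (((W.baseChange K).baseChange (v₀.adicCompletion K)).localTamagawaNumber
      (v₀.adicCompletionIntegers K)).factorization p < k := by rw [hfac]; exact htk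
  -- `N ∈ τ • v₀` as well
  have hv₀N' : ((W.conductorNorm ℤ : ℕ) : 𝓞 K) ∈ (τ • v₀).asIdeal := by
    have := (HeightOneSpectrum.smul_mem_smul_asIdeal_iff τ v₀ ((W.conductorNorm ℤ : ℕ) : 𝓞 K)).mpr hv₀N
    have hτN : τ • ((W.conductorNorm ℤ : ℕ) : 𝓞 K) = ((W.conductorNorm ℤ : ℕ) : 𝓞 K) := by
      rw [← MulSemiringAction.toRingHom_apply, map_natCast]
    rwa [hτN] at this
  -- the intrinsic transverse family (for `h49tr` from `htr` at level `cℓ`)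
  obtain ⟨𝒯, h𝒯, hT⟩ := exists_localTransverseFamily W ι ((p ^ k : ℕ) : ℤ) hc0'
  have key := tamagawaExponent_le_mInfty_of_localFacts' h44 W hcm K hK hD3 hD4 hH (hPT K) p hp2 htower
    Dt β ι τ hτ hτ2 ε hε h53' hcop' hGZ' mdiv m hmdiv hm k hn c hk hcore mInf hmc hkM hik v₀ hv₀ hv₀N
    hc0 htk'
    (fun 𝒯' h𝒯' ↦ h𝒯σ W K hK ι τ hτ p k hp2 c.1 c.2.1 hcK 𝒯' h𝒯')
    (fun 𝒯' h𝒯' e hμ hadd₁ hadd₂ hgal halt hnondeg ↦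
      h𝒯sd W K hK ι p k hp2 c.1 c.2.1 hcK 𝒯' h𝒯' e hμ hadd₁ hadd₂ hgal halt hnondeg)
    (fun ℓ h1 h2 _ v hv hfix s hs ↦ hloc W K hK τ hτ p k hp2 hk ℓ h1 h2 v hv hfix s hs)
    (fun d ℓ hℓ ↦ htr W K hK p hp2 Dt β ι k c.1 c.2.1 hcK d ℓ hℓ)
    (fun ℓ h1 h2 h3 d' q hq ↦ by
      simp only [Finset.mem_insert, Finset.mem_singleton] at hq
      rcases hq with rfl | rfl
      · exact h49str W K hK hH p hp2 Dt β ι k hn c.1 c.2.1 hcK q hv₀N ℓ h1 h2 h3 d'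
      · exact h49str W K hK hH p hp2 Dt β ι k hn c.1 c.2.1 hcK _ hv₀N' ℓ h1 h2 h3 d')
    (fun ℓ h1 h2 h3 d' w hw ↦ by
      -- `h49tr` from `htr` at level `cℓ` through the reconciliation `hT`
      have hl : ℓ.Prime := h1.1
      have hlc : ¬ ℓ ∣ c.1 := fun h ↦ h3 (Nat.mem_primeFactors.mpr ⟨hl, h, hc0'⟩)
      have hcl : Squarefree (c.1 * ℓ) :=
        (Nat.squarefree_mul ((Nat.Prime.coprime_iff_not_dvd hl).mpr hlc).symm).mpr ⟨c.2.1, hl.squarefree⟩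
      have hpf : (c.1 * ℓ).primeFactors = c.1.primeFactors ∪ {ℓ} := by
        rw [Nat.primeFactors_mul hc0' hl.ne_zero, hl.primeFactors]
      have hcKℓ : ∀ l' ∈ (c.1 * ℓ).primeFactors, Zhang2014.IsKolyvaginPrime (W.conductorNorm ℤ) W K p l' ∧
          k ≤ Zhang2014.kolyvaginIndex W p l' := by
        intro l' hl'
        rw [hpf, Finset.mem_union, Finset.mem_singleton] at hl'
        rcases hl' with h | rfl
        · exact hcK l' h
        · exact ⟨h1, h2⟩
      rw [← h𝒯 w]
      refine (hT _).mpr (fun l' hl' ↦ ?_) w hw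
      exact htr W K hK p hp2 Dt β ι k (c.1 * ℓ) hcl hcKℓ d' l'
        (by rw [hpf]; exact Finset.mem_union_left _ hl'))
  rw [hfac] at key
  exact key

end Summit.BirchSwinnertonDyer.Rank1Residual.JET

end
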